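import Mathlib
import Literature.NumberTheory.Sieve.BatemanHornProofs
import Literature.NumberTheory.LFunctions.PolynomialRootMoebiusSharpCutoff

/-!
# Crux `PolyMobiusTail` (stmt-Parity-0870), line `Sketch` (natural form): stub `stub_kernel_fin_one`

The registered stub `stub_kernel_fin_one` of the lead's skeleton
`Summits/Parity/BatemanHorn/Cruxes/PolyMobiusTail/Lines/Sketch.lean`: the analytic kernel bound
`|V_S(y)| ≤ C/(log y)^{|S|+1}` (`y ≥ 2`) on the truncated signed singular sum, in the case `k = 1`
(then `S = univ` and there is no log weight), i.e. `|∑_{d ≤ y} μ(d)ρ_g(d)/d| ≤ C/(log y)^2` for the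
single member `g = f 0` of a one-member Bateman–Horn system.  This is Landau's theorem for
`∑ μ(n)ρ_g(n)/n` in sharp-cutoff form, PROVED in the tree as
`Literature.NumberTheory.LFunctions.abs_sum_moebius_rootCount_div_le` (from the log-Riesz form with
de la Vallée-Poussin rate plus the short-interval mass of `|μρ_g|`); this file is the `Fin 1`
bookkeeping only.  The case `k ≥ 2` (registered stub `stub_kernel_two_le`) is open.
-/

open scoped BigOperators
open Filter Finset Polynomial

namespace Summit.Parity.BatemanHorn.Theorems.PolyMobiusTail.NaturalForm

open Literature.NumberTheory.Sieve

/-- **Stub `stub_kernel_fin_one`** (the kernel bound for `k = 1`): for a one-member Bateman–Horn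
system `f = (g)` and non-empty `S ⊆ Fin 1` (so `S = univ`, no log weight),
`|∑_{d ≤ y} μ(d) ρ_g(d)/d| ≤ C/(log y)^2` for `y ≥ 2` — Landau's theorem in `M`-function form
(tree: `Literature.NumberTheory.LFunctions.abs_sum_moebius_rootCount_div_le`). -/
theorem stub_kernel_fin_one : ∀ (f : Fin 1 → ℤ[X]),
    Literature.NumberTheory.Sieve.IsBatemanHornSystem f → ∀ S : Finset (Fin 1), S.Nonempty →
      ∃ C : ℝ, ∀ y : ℝ, 2 ≤ y →
        |∑ d ∈ Fintype.piFinset (fun _ : Fin 1 => Finset.Icc 1 ⌊y⌋₊),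
            if ∏ i, (d i : ℝ) ≤ y then
              (∏ i, (ArithmeticFunction.moebius (d i) : ℝ)) * (∏ i ∈ Finset.univ \ S, Real.log (d i)) *
                ((((Finset.range (∏ i, d i)).filter
                    (fun n : ℕ => ∀ i, ((d i : ℕ) : ℤ) ∣ (f i).eval (n : ℤ))).card : ℝ) / ∏ i, (d i : ℝ))
            else 0|
          ≤ C / Real.log y ^ (S.card + 1) := by
  intro f hf S hS
  have hSu : S = Finset.univ := by
    refine Finset.eq_univ_of_card _ (le_antisymm (Finset.card_le_univ S) ?_)
    rw [Fintype.card_fin]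
    exact hS.card_pos
  subst hSu
  obtain ⟨C, hC⟩ :=
    Literature.NumberTheory.LFunctions.abs_sum_moebius_rootCount_div_le
      (hf.irreducible 0) (hf.natDegree_pos 0)
  refine ⟨C, fun y hy => ?_⟩
  have hy0 : 0 ≤ y := by linarith
  set F : ℕ → ℝ := fun m => if (m : ℝ) ≤ y then
      (ArithmeticFunction.moebius m : ℝ) * 1 * ((polyRootCountMod ![f 0] m : ℝ) / m) else 0 with hF
  have hterm : ∀ d : Fin 1 → ℕ,
      (if ∏ i, (d i : ℝ) ≤ y then
          (∏ i, (ArithmeticFunction.moebius (d i) : ℝ)) *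
              (∏ i ∈ Finset.univ \ Finset.univ, Real.log (d i)) *
            ((((Finset.range (∏ i, d i)).filter
                (fun n : ℕ => ∀ i, ((d i : ℕ) : ℤ) ∣ (f i).eval (n : ℤ))).card : ℝ) / ∏ i, (d i : ℝ))
        else 0) = F (d 0) := by
    intro d
    simp only [hF, Fin.prod_univ_one, Fin.forall_fin_one, Finset.sdiff_self, Finset.prod_empty,
      Literature.NumberTheory.LFunctions.polyRootCountMod_single_eq_card]
  rw [Finset.sum_congr rfl fun d _ => hterm d, Fintype.sum_piFinset_apply F (Finset.Icc 1 ⌊y⌋₊) 0]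
  simp only [Fintype.card_fin, Nat.sub_self, pow_zero, one_smul, Finset.card_univ]
  have hF' : ∀ m ∈ Finset.Icc 1 ⌊y⌋₊,
      F m = (ArithmeticFunction.moebius m : ℝ) * (polyRootCountMod ![f 0] m : ℝ) / m := by
    intro m hm
    rw [Finset.mem_Icc] at hm
    have hmy : (m : ℝ) ≤ y := (Nat.cast_le.mpr hm.2).trans (Nat.floor_le hy0)
    rw [hF]
    simp only [if_pos hmy]
    ring
  rw [Finset.sum_congr rfl hF']
  exact hC y hy

end Summit.Parity.BatemanHorn.Theorems.PolyMobiusTail.NaturalForm
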